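import Summits.ResolutionOfSingularities.ResolutionOfSingularities.Theorems.MarkedTransferCampaignW23KnockOutOrderBoundary
import Summits.ResolutionOfSingularities.ResolutionOfSingularities.Theorems.MarkedTransferCampaignW23Thm918FlagChainsProof
import Mathlib.RingTheory.PowerSeries.Inverse
import Mathlib.Algebra.CharP.Algebra
import Mathlib.Algebra.CharP.Lemmas
import HarnessLib

/-!
# [OURS · L1 W2.3] The order clause of Eq. (84) (5) is sharp — PROOF of `CampaignW23.KnockOutOrderBoundary`
# (RESCUE-SEED slot W2.3 «tails without `H♭`», group L-G2; cell `res-hironaka`, rung L of LADDER-RESOLUTION)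

HONEST FRAMING. Everything here is OURS; NOTHING is a statement of H. Hironaka's manuscript [Hironaka2017]; no typed
carrier of the manuscript is used. AI review is weaker than expert review.

PROVED HERE (0 `sorry`, axioms ⊆ {propext, Classical.choice, Quot.sound}): `knockOutOrderBoundary_holds p :
KnockOutOrderBoundary p` for every prime `p`, from three small facts about `K⟦X⟧` (`K` a field):
`φ ∈ max^n ↔ X^n ∣ φ` (`PowerSeries.maximalIdeal_eq_span_X`), `ord(C u · X^n) = n` for `u ≠ 0`, `ord X^{n+1} > n`;
the characteristic of `K⟦X⟧` is transported along `C` (`charP_of_injective_ringHom`), and `(1+a)^p = 1 + a^p`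
(`add_pow_char`) computes the knock-out `−a^p X^p + X^{p+1}`, whose order is `p` by `adicOrder_add_eq_of_lt` (p479539).

## References
* Tree (OURS): `Theorems/MarkedTransferCampaignW23KnockOutOrderBoundary.lean` (statement),
  `…Thm918FlagChains.lean` (p478724) / `…Thm918FlagChainsProof.lean` (p479539).
* H. Hironaka, ms. 2017-03-23: Eq. (84) (5), Th. 9.18 (1) p.55 — scope only, under adjudication. [Hironaka2017]
-/

set_option linter.dupNamespace false -- mandated namespace of this single-conjunct summit

namespace Summit.ResolutionOfSingularities.ResolutionOfSingularities.Theorems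

namespace CampaignW23

open Literature.AlgebraicGeometry.Resolution
open IsLocalRing

namespace PowerSeriesBoundary

open PowerSeries

variable {K : Type} [Field K]

/-- In `K⟦X⟧`: `φ ∈ max^n ↔ X^n ∣ φ`. [folklore] -/
theorem mem_maximalIdeal_pow_iff (n : ℕ) (φ : PowerSeries K) :
    φ ∈ maximalIdeal (PowerSeries K) ^ n ↔ (X : PowerSeries K) ^ n ∣ φ := by
  rw [maximalIdeal_eq_span_X, Ideal.span_singleton_pow, Ideal.mem_span_singleton]

/-- In `K⟦X⟧`: `ord (C u · X^n) = n` for `u ≠ 0`. [folklore] -/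
theorem adicOrder_C_mul_X_pow {u : K} (hu : u ≠ 0) (n : ℕ) :
    adicOrder (C u * X ^ n : PowerSeries K) = n := by
  apply le_antisymm
  · rw [adicOrder_le_iff, mem_maximalIdeal_pow_iff, X_pow_dvd_iff]
    intro h
    have h' := h n (Nat.lt_succ_self n)
    rw [coeff_C_mul, coeff_X_pow, if_pos rfl, mul_one] at h'
    exact hu h'
  · rw [le_adicOrder_iff, mem_maximalIdeal_pow_iff]
    exact Dvd.intro_left _ rfl

/-- In `K⟦X⟧`: `n < ord (X^(n+1))`. [folklore] -/
theorem lt_adicOrder_X_pow_succ (n : ℕ) : (n : ℕ∞) < adicOrder (X ^ (n + 1) : PowerSeries K) := by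
  have h : ((n + 1 : ℕ) : ℕ∞) ≤ adicOrder (X ^ (n + 1) : PowerSeries K) := by
    rw [le_adicOrder_iff, mem_maximalIdeal_pow_iff]
  have h1 : (n : ℕ∞) < ((n + 1 : ℕ) : ℕ∞) := by exact_mod_cast Nat.lt_succ_self n
  exact lt_of_lt_of_le h1 h

end PowerSeriesBoundary

open PowerSeries PowerSeriesBoundary in
/-- [OURS · L1 W2.3] `KnockOutOrderBoundary p` HOLDS for every prime `p`. [folklore] -/
theorem knockOutOrderBoundary_holds (p : ℕ) [Fact p.Prime] : KnockOutOrderBoundary p := by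
  intro K _ _ a ha
  have hp : p.Prime := Fact.out
  refine ⟨?_, ?_, ?_, ?_⟩
  · rw [pow_one]
    exact lt_adicOrder_X_pow_succ p
  · rw [pow_one]
  · -- the knock-out is `C(-a^p) X^p + X^(p+1)`
    haveI : CharP (PowerSeries K) p := charP_of_injective_ringHom (PowerSeries.C_injective) p
    have hko : (X ^ p + X ^ (p + 1) : PowerSeries K) - (C (1 + a) * X) ^ p = C (-a ^ p) * X ^ p + X ^ (p + 1) := by
      rw [mul_pow, ← map_pow, add_pow_char, one_pow, map_neg, map_add, map_one, map_pow]
      ring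
    rw [hko, show 1 - 0 = 1 from rfl, pow_one]
    have hap : -a ^ p ≠ 0 := neg_ne_zero.mpr (pow_ne_zero _ ha)
    exact adicOrder_add_eq_of_lt (adicOrder_C_mul_X_pow hap p) (lt_adicOrder_X_pow_succ p)
  · rw [Nat.sub_self, pow_zero, pow_one, mem_maximalIdeal_pow_iff, X_pow_dvd_iff]
    intro h
    have h' := h 1 (by norm_num)
    rw [map_add, map_one, add_mul, one_mul, add_sub_cancel_left, coeff_C_mul, coeff_one_X, mul_one] at h'
    exact ha h'

end CampaignW23

end Summit.ResolutionOfSingularities.ResolutionOfSingularities.Theorems
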